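import Summits.AnomalousDissipation.AnomalousDissipation.Theses.MomentParity
import Literature.Analysis.FluidPDE.StatisticalSolutionEnergyEq
import Literature.Analysis.FluidPDE.StatisticalSolutionProofs
import Literature.Analysis.FunctionSpaces.TorusFourierModes
import Literature.Analysis.FunctionSpaces.TorusEnstrophyOrthogonality
import Literature.Analysis.FunctionSpaces.TorusFluidGlueProofs

/-!
# `MomentParity.PlanarCubicQuiet` (stmt-AnomalousDissipation-11468), I: the ENSTROPHY ROW
# (the order-3 test `Σᵢ 2π²|kᵢ|² Xᵢ²`, its differential `A P_N u`, and the 2-D inertial cancellation)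

Support file for the proof of `Summit.AnomalousDissipation.AnomalousDissipation.Theses.MomentParity.PlanarCubicQuiet`
(closing file `MomentParityPlanarCubicQuiet.lean`). The quadratic observable
`½ Σ_p 4π²|k_p|² (u, g_p)²` over the Parseval frame `g_p` of `P_N H` (`Torus.frameField`, the fields of
`Torus.galerkinTest N`) is an admissible test of the route's 3-stationarity clause (`totalDegree 2`,
`totalDegree_sum_C_mul_X_sq`, `galerkinTest_band`); its differential is the Stokes truncation
`A P_N u = -Δ P_N u = Re Σ_{|k|≤N} e_k 4π²|k|² û(k)` (`polyGrad_stokes`, `stokesTruncate_eq_neg_laplacian`);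
the Stokes term of the tested generator is `-‖A P_N u‖² = -16π⁴ Σ |k|⁴ ‖û(k)‖²`
(`integral_inner_laplacian_stokesTruncate`); on level-`N` fields `P_N u = u` a.e.
(`fourierTruncate_ae_eq_of_level`), the enstrophy is the finite mode sum (`eGradNormSq_eq_ofReal_of_level`),
and in TWO dimensions the inertial term against `A u` vanishes, `b(u, u, Au) = 0`
(`inertialPairing_stokesTruncate_eq_zero`, from `Torus.integral_inner_laplacian_convect_self_eq_zero`,
FMRT (A.62)), so the row integrand is `∫ ⟪f, A P_N u⟫ − ν ‖A P_N u‖²`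
(`nsGeneratorPairing_stokesTruncate_of_level`).

References: A. Alexakis, C. Doering, Phys. Lett. A 359 (2006) 652–657, §2; C. Foias, O. Manley,
R. Rosa, R. Temam, *Navier–Stokes Equations and Turbulence* (CUP 2001), Ch. IV §1.2, App. II.A (A.62).
-/

noncomputable section

-- `Summit.<Summit>.<Problem>` is the tree's mandated summit-side namespace (CONVENTIONS §2); for this
-- single-conjunct summit the two coincide, so the duplicate is deliberate.
set_option linter.dupNamespace false

namespace Summit.AnomalousDissipation.AnomalousDissipation.Theorems

open MeasureTheory Filter UnitAddTorus
open scoped InnerProductSpace RealInnerProductSpace ENNReal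
open Literature.Analysis.FunctionSpaces Literature.Analysis.FluidPDE
open Summit.AnomalousDissipation.AnomalousDissipation.Theses.MomentParity

namespace PlanarCubicQuiet

variable {d : Type*} [Fintype d] [DecidableEq d]

/-- Local notation: real vector fields on `T^d`. -/
local notation "Vec " d':max => UnitAddTorus d' → EuclideanSpace ℝ d'
/-- Local notation: the real Hilbert space `L²(T^d; ℝ^d)`. -/
local notation "L2T " d':max => Lp (EuclideanSpace ℝ d') 2 (volume : Measure (UnitAddTorus d'))
/-- Local notation: the energy space `H`. -/
local notation "HH " d':max => Torus.energySpace d'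

/-! ## The weighted quadratic test polynomial `Σᵢ aᵢ Xᵢ²` -/

/-- `Σᵢ C aᵢ · Xᵢ²` has total degree `≤ 2`, hence is an admissible order-3 test. [folklore] -/
theorem totalDegree_sum_C_mul_X_sq {n : ℕ} (a : Fin n → ℝ) :
    (∑ i : Fin n, MvPolynomial.C (a i) * MvPolynomial.X i ^ 2 : MvPolynomial (Fin n) ℝ).totalDegree
      + 1 ≤ 3 := by
  have : (∑ i : Fin n, MvPolynomial.C (a i) * MvPolynomial.X i ^ 2 :
      MvPolynomial (Fin n) ℝ).totalDegree ≤ 2 := by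
    refine (MvPolynomial.totalDegree_finsetSum _ _).trans ?_
    refine Finset.sup_le fun i _ => ?_
    refine (MvPolynomial.totalDegree_mul _ _).trans ?_
    rw [MvPolynomial.totalDegree_C, MvPolynomial.totalDegree_X_pow]
  omega

/-- `∂ᵢ (Σⱼ aⱼ Xⱼ²) = 2 aᵢ Xᵢ`, evaluated. [folklore] -/
theorem eval_pderiv_sum_C_mul_X_sq {n : ℕ} (a : Fin n → ℝ) (v : Fin n → ℝ) (i : Fin n) :
    MvPolynomial.eval v (MvPolynomial.pderiv i
      (∑ j : Fin n, MvPolynomial.C (a j) * MvPolynomial.X j ^ 2 : MvPolynomial (Fin n) ℝ)) =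
      2 * a i * v i := by
  simp [map_sum, Derivation.leibniz_pow, MvPolynomial.pderiv_X, Pi.single_apply,
    Finset.sum_ite_eq', mul_comm, mul_left_comm, mul_assoc]

/-! ## The weighted Galerkin frame reproduces weighted truncations -/

/-- **Weighted frame identity**: for `v ∈ H`, real weights `W` and `x ∈ T^d`,
`Σ_{0<|k|≤m} Σⱼ Σ_c W(k) (v, g_{kjc}) g_{kjc}(x) = Re Σ_{|k|≤m} e_k(x) W(k) v̂(k)`, the real
trigonometric polynomial with coefficients `W(k) v̂(k)` (the frame of `StatisticalSolutionEnergyEq`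
reproduces each Fourier mode of a weakly divergence-free field). [folklore] -/
theorem sum_weight_integral_inner_frameField_smul {v : L2T d} (hv : v ∈ Torus.energySpace d)
    (W : (d → ℤ) → ℝ) (m : ℕ) (x : UnitAddTorus d) :
    ∑ k ∈ Torus.freqBall₀ m, ∑ j, ∑ c,
        (W k * ∫ y, ⟪(v : Vec d) y, Torus.frameField k j c y⟫_ℝ) • Torus.frameField k j c x =
      Torus.realTrigPoly (Torus.freqBall m)
        (fun k => ((W k : ℝ) : ℂ) • mFourierCoeff (EuclideanSpace.complexify ∘ (v : Vec d)) k) x := by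
  have hmem : MemLp (v : Vec d) 2 volume := Lp.memLp v
  have hint : Integrable (v : Vec d) volume := hmem.integrable one_le_two
  have hdiv := Torus.isWeaklyDivFree_of_mem_energySpace hv
  have key : ∀ k ∈ Torus.freqBall₀ m, ∑ j, ∑ c,
      (W k * ∫ y, ⟪(v : Vec d) y, Torus.frameField k j c y⟫_ℝ) • Torus.frameField k j c x =
      EuclideanSpace.realPart (mFourier k x •
        (((W k : ℝ) : ℂ) • mFourierCoeff (EuclideanSpace.complexify ∘ (v : Vec d)) k)) := by
    intro k _
    have h1 : ∑ j, ∑ c,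
        (W k * ∫ y, ⟪(v : Vec d) y, Torus.frameField k j c y⟫_ℝ) • Torus.frameField k j c x =
        W k • ∑ j, ∑ c,
          (∫ y, ⟪(v : Vec d) y, Torus.frameField k j c y⟫_ℝ) • Torus.frameField k j c x := by
      simp_rw [Finset.smul_sum, smul_smul]
    rw [h1]
    simp_rw [Torus.frameField, Torus.integral_inner_realTrigPoly_singleton hint,
      Torus.realTrigPoly_singleton_apply, Torus.smul_realPart_mFourier_smul, ← map_sum,
      ← Finset.smul_sum]
    rw [Torus.sum_sum_re_inner_frameVec_smul (hdiv.sum_mul_mFourierCoeff_eq_zero hmem k),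
      Torus.smul_realPart_mFourier_smul]
  rw [Finset.sum_congr rfl key, Torus.freqBall₀, Finset.sum_erase _ (by
    rw [Torus.mFourierCoeff_complexify_coe_zero_of_mem hv, smul_zero, smul_zero, map_zero]),
    Torus.realTrigPoly_apply_eq_sum]

/-- Sums over the `Fin`-indexed fields of `Torus.galerkinTest` are sums over the frame index
`(k, j, c)`, for summands that may depend on the frequency `k`. [folklore] -/
theorem sum_galerkinTest_idx_eq {M : Type*} [AddCommMonoid M] (m : ℕ) {a : ℝ} (ha : 0 < a)
    (F : (d → ℤ) → (UnitAddTorus d → EuclideanSpace ℝ d) → M) :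
    ∑ i : Fin (Torus.galerkinTest (d := d) m ha).m,
        F (((Fintype.equivFin (Torus.FrameIdx d m)).symm i).1 : d → ℤ)
          ((Torus.galerkinTest m ha).g i) =
      ∑ k ∈ Torus.freqBall₀ m, ∑ j, ∑ c, F k (Torus.frameField k j c) := by
  have h1 : ∑ i : Fin (Torus.galerkinTest (d := d) m ha).m,
      F (((Fintype.equivFin (Torus.FrameIdx d m)).symm i).1 : d → ℤ) ((Torus.galerkinTest m ha).g i) =
      ∑ p : Torus.FrameIdx d m, F (p.1 : d → ℤ) (Torus.frameFieldIdx m p) :=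
    Fintype.sum_equiv (Fintype.equivFin (Torus.FrameIdx d m)).symm _ _ fun _ => rfl
  rw [h1, Fintype.sum_prod_type, ← Finset.sum_coe_sort (Torus.freqBall₀ m)]
  refine Finset.sum_congr rfl fun k _ => ?_
  rw [Fintype.sum_prod_type]
  rfl

/-- **The differential of the enstrophy observable is the Stokes truncation.** With the frame
`g = (Torus.galerkinTest N).g` and the weights `aᵢ = 2π² |kᵢ|²`, for every `u ∈ H` and `x`,
`Σᵢ ∂ᵢP((u,g)) gᵢ(x) = Re Σ_{|k|≤N} e_k(x) 4π²|k|² û(k) = (A P_N u)(x)` for `P = Σᵢ aᵢ Xᵢ²`.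
[folklore] -/
theorem polyGrad_stokes (N : ℕ) (u : HH d) (x : UnitAddTorus d) :
    ∑ i : Fin (Torus.galerkinTest (d := d) N one_pos).m,
        (MvPolynomial.eval (fun j => Torus.pairing u.1 ((Torus.galerkinTest (d := d) N one_pos).g j))
          (MvPolynomial.pderiv i
            (∑ j : Fin (Torus.galerkinTest (d := d) N one_pos).m,
              MvPolynomial.C (2 * Real.pi ^ 2 * Torus.freqNormSq
                (((Fintype.equivFin (Torus.FrameIdx d N)).symm j).1 : d → ℤ)) *
                MvPolynomial.X j ^ 2 : MvPolynomial (Fin (Torus.galerkinTest (d := d) N one_pos).m) ℝ))) •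
          (Torus.galerkinTest (d := d) N one_pos).g i x =
      Torus.realTrigPoly (Torus.freqBall N)
        (fun k => (((4 * Real.pi ^ 2 * Torus.freqNormSq k : ℝ)) : ℂ) •
          mFourierCoeff (EuclideanSpace.complexify ∘ ((u : L2T d) : Vec d)) k) x := by
  simp_rw [eval_pderiv_sum_C_mul_X_sq]
  have h := sum_galerkinTest_idx_eq (d := d) N one_pos
    (fun k g => (2 * (2 * Real.pi ^ 2 * Torus.freqNormSq k) * Torus.pairing u.1 g) • g x)
  rw [h]
  have h2 := sum_weight_integral_inner_frameField_smul u.2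
    (fun k => 4 * Real.pi ^ 2 * Torus.freqNormSq k) N x
  rw [← h2]
  refine Finset.sum_congr rfl fun k _ => Finset.sum_congr rfl fun j _ =>
    Finset.sum_congr rfl fun c _ => ?_
  rw [Torus.pairing]
  congr 1
  ring

/-! ## The Stokes truncation `A P_N v = Re Σ_{|k|≤N} e_k 4π²|k|² v̂(k)` -/

/-- The Stokes truncation is minus the Laplacian of the Fourier truncation:
`Re Σ_{|k|≤N} e_k(x) 4π²|k|² v̂(k) = -Δ(P_N v)(x)`. [folklore] -/
theorem stokesTruncate_eq_neg_laplacian (N : ℕ) (v : Vec d) (x : UnitAddTorus d) :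
    Torus.realTrigPoly (Torus.freqBall N)
        (fun k => (((4 * Real.pi ^ 2 * Torus.freqNormSq k : ℝ)) : ℂ) •
          mFourierCoeff (EuclideanSpace.complexify ∘ v) k) x =
      -Torus.laplacian (Torus.fourierTruncate N v) x := by
  rw [Torus.fourierTruncate_eq, Torus.laplacian_realTrigPoly]
  have h : (fun k => -((((4 * Real.pi ^ 2 * Torus.freqNormSq k : ℝ)) : ℂ) •
      mFourierCoeff (EuclideanSpace.complexify ∘ v) k)) =
      (0 : (d → ℤ) → EuclideanSpace ℂ d) - fun k => (((4 * Real.pi ^ 2 * Torus.freqNormSq k : ℝ)) : ℂ) •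
        mFourierCoeff (EuclideanSpace.complexify ∘ v) k := by
    funext k
    simp
  rw [h, Torus.realTrigPoly_sub, Torus.realTrigPoly_zero]
  simp

/-- **The Stokes term of the enstrophy row**: for integrable `v`,
`∫ ⟪v, Δ(A P_N v)⟫ = -16π⁴ Σ_{|k|≤N} |k|⁴ ‖v̂(k)‖² = -‖A P_N v‖₂²`. [folklore] -/
theorem integral_inner_laplacian_stokesTruncate {v : Vec d} (hv : Integrable v volume) (N : ℕ) :
    ∫ x, ⟪v x, Torus.laplacian (Torus.realTrigPoly (Torus.freqBall N)
        (fun k => (((4 * Real.pi ^ 2 * Torus.freqNormSq k : ℝ)) : ℂ) •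
          mFourierCoeff (EuclideanSpace.complexify ∘ v) k)) x⟫_ℝ =
      -∑ k ∈ Torus.freqBall N, (4 * Real.pi ^ 2 * Torus.freqNormSq k) ^ 2 *
        ‖mFourierCoeff (EuclideanSpace.complexify ∘ v) k‖ ^ 2 := by
  have hlap : Torus.laplacian (Torus.realTrigPoly (Torus.freqBall N)
      (fun k => (((4 * Real.pi ^ 2 * Torus.freqNormSq k : ℝ)) : ℂ) •
        mFourierCoeff (EuclideanSpace.complexify ∘ v) k)) =
      Torus.realTrigPoly (Torus.freqBall N) (fun k =>
        -((((4 * Real.pi ^ 2 * Torus.freqNormSq k : ℝ)) : ℂ) •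
          ((((4 * Real.pi ^ 2 * Torus.freqNormSq k : ℝ)) : ℂ) •
            mFourierCoeff (EuclideanSpace.complexify ∘ v) k))) :=
    funext fun x => Torus.laplacian_realTrigPoly _ _ x
  rw [hlap, Torus.integral_inner_realTrigPoly_of_integrable _ _ hv, ← Finset.sum_neg_distrib]
  refine Finset.sum_congr rfl fun k _ => ?_
  have hW : (inner ℂ (mFourierCoeff (EuclideanSpace.complexify ∘ v) k)
      (mFourierCoeff (EuclideanSpace.complexify ∘ v) k)).re =
      ‖mFourierCoeff (EuclideanSpace.complexify ∘ v) k‖ ^ 2 := by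
    have := inner_self_eq_norm_sq (𝕜 := ℂ) (mFourierCoeff (EuclideanSpace.complexify ∘ v) k)
    simpa using this
  rw [inner_neg_right, inner_smul_right, inner_smul_right, Complex.neg_re, ← mul_assoc,
    ← Complex.ofReal_mul, Complex.re_ofReal_mul, hW]
  ring

/-! ## Level-`N` fields: `P_N u = u` a.e., finite enstrophy, the 2-D inertial cancellation -/

section Level

variable {N : ℕ} {u : HH d}

/-- A level-`N` field has no tail enstrophy beyond `N`. [folklore] -/
theorem tailGradNormSq_eq_zero_of_level
    (hu : ∀ k ∉ (Torus.freqBall N).erase (0 : d → ℤ),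
      mFourierCoeff (EuclideanSpace.complexify ∘ ((u : L2T d) : Vec d)) k = 0) :
    Torus.tailGradNormSq N ((u : L2T d) : Vec d) = 0 := by
  rw [Torus.tailGradNormSq, ENNReal.tsum_eq_zero.2, mul_zero]
  intro k
  have : mFourierCoeff (EuclideanSpace.complexify ∘ ((u : L2T d) : Vec d)) (k : d → ℤ) = 0 :=
    hu k (fun h => k.2 (Finset.mem_of_mem_erase h))
  rw [this]
  simp

/-- **A level-`N` field is its own truncation**, `P_N u = u` a.e. on `T^d`. [folklore] -/
theorem fourierTruncate_ae_eq_of_level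
    (hu : ∀ k ∉ (Torus.freqBall N).erase (0 : d → ℤ),
      mFourierCoeff (EuclideanSpace.complexify ∘ ((u : L2T d) : Vec d)) k = 0) :
    (fun x => Torus.fourierTruncate N ((u : L2T d) : Vec d) x) =ᵐ[volume] ((u : L2T d) : Vec d) := by
  have hmem : MemLp ((u : L2T d) : Vec d) 2 volume := Lp.memLp (u : L2T d)
  have htail := tailGradNormSq_eq_zero_of_level hu
  have hle := Torus.integral_norm_sq_fourierTruncate_sub_le hmem N
    (by rw [htail]; exact ENNReal.zero_ne_top)
  rw [htail, ENNReal.toReal_zero, zero_div] at hle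
  have hint : Integrable (fun x => ‖Torus.fourierTruncate N ((u : L2T d) : Vec d) x -
      ((u : L2T d) : Vec d) x‖ ^ 2) volume :=
    ((Torus.memLp_fourierTruncate N _ 2).sub hmem).integrable_norm_pow two_ne_zero
  have h0 : ∫ x, ‖Torus.fourierTruncate N ((u : L2T d) : Vec d) x - ((u : L2T d) : Vec d) x‖ ^ 2 = 0 :=
    le_antisymm hle (integral_nonneg fun _ => by positivity)
  have hae := (integral_eq_zero_iff_of_nonneg (fun _ => by positivity) hint).1 h0
  filter_upwards [hae] with x hx
  have hx' : ‖Torus.fourierTruncate N ((u : L2T d) : Vec d) x - ((u : L2T d) : Vec d) x‖ ^ 2 = 0 := hx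
  exact sub_eq_zero.1 (norm_eq_zero.1 (pow_eq_zero_iff two_ne_zero |>.1 hx'))

/-- **The enstrophy of a level-`N` field** is the finite mode sum
`‖∇u‖₂² = 4π² Σ_{|k|≤N} |k|² ‖û(k)‖²`. [folklore] -/
theorem eGradNormSq_eq_ofReal_of_level
    (hu : ∀ k ∉ (Torus.freqBall N).erase (0 : d → ℤ),
      mFourierCoeff (EuclideanSpace.complexify ∘ ((u : L2T d) : Vec d)) k = 0) :
    Torus.eGradNormSq ((u : L2T d) : Vec d) =
      ENNReal.ofReal (4 * Real.pi ^ 2 * ∑ k ∈ Torus.freqBall N, Torus.freqNormSq k *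
        ‖mFourierCoeff (EuclideanSpace.complexify ∘ ((u : L2T d) : Vec d)) k‖ ^ 2) := by
  have hint : Integrable ((u : L2T d) : Vec d) volume := (Lp.memLp (u : L2T d)).integrable one_le_two
  have h1 : Torus.eGradNormSq ((u : L2T d) : Vec d) =
      Torus.eGradNormSq (Torus.fourierTruncate N ((u : L2T d) : Vec d)) := by
    rw [Torus.eGradNormSq_eq_tsum, Torus.eGradNormSq_eq_tsum]
    congr 1
    refine tsum_congr fun k => ?_
    rw [Torus.mFourierCoeff_fourierTruncate hint]
    split_ifs with hk
    · rfl
    · rw [hu k (fun h => hk (Finset.mem_of_mem_erase h))]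
  rw [h1, Torus.fourierTruncate_eq, Torus.eGradNormSq_realTrigPoly Torus.neg_mem_freqBall_of_mem
    (Torus.isConjSymm_mFourierCoeff hint)]

end Level

/-- **The 2-D inertial cancellation on level-`N` fields**: on `𝕋²`, for `u ∈ H` carried by the
level-`N` modes, `∫ (u ⊗ u) : ∇(A P_N u) = b(u, u, Au) = 0` (`u = P_N u` a.e., antisymmetry of the
trilinear form, and FMRT (A.62) `∫ ⟪Δu, (u·∇)u⟫ = 0`). [cite: FoiasManleyRosaTemam2001, App. II.A (A.62)] -/
theorem inertialPairing_stokesTruncate_eq_zero {N : ℕ} {u : HH (Fin 2)}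
    (hu : ∀ k ∉ (Torus.freqBall N).erase (0 : Fin 2 → ℤ),
      mFourierCoeff (EuclideanSpace.complexify ∘ ((u : L2T (Fin 2)) : Vec (Fin 2))) k = 0) :
    Torus.inertialPairing (u : L2T (Fin 2)) (Torus.realTrigPoly (Torus.freqBall N)
        (fun k => (((4 * Real.pi ^ 2 * Torus.freqNormSq k : ℝ)) : ℂ) •
          mFourierCoeff (EuclideanSpace.complexify ∘ ((u : L2T (Fin 2)) : Vec (Fin 2))) k)) = 0 := by
  rw [Torus.inertialPairing]
  set v : Vec (Fin 2) := ((u : L2T (Fin 2)) : Vec (Fin 2)) with hv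
  set p := Torus.fourierTruncate N v with hp_def
  set w := Torus.realTrigPoly (Torus.freqBall N)
        (fun k => (((4 * Real.pi ^ 2 * Torus.freqNormSq k : ℝ)) : ℂ) •
          mFourierCoeff (EuclideanSpace.complexify ∘ v) k) with hw_def
  have hmem : MemLp v 2 volume := Lp.memLp (u : L2T (Fin 2))
  have hp : Torus.IsSmooth p := Torus.isSmooth_fourierTruncate N v
  have hpdiv : Torus.IsDivFree p :=
    Torus.isDivFree_fourierTruncate hmem (Torus.isWeaklyDivFree_of_mem_energySpace u.2) N
  have hw : Torus.IsSmooth w := Torus.isSmooth_realTrigPoly _ _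
  have hw_eq : ∀ x, w x = -Torus.laplacian p x := fun x => stokesTruncate_eq_neg_laplacian N v x
  -- replace `v` by its truncation `p` (a.e. equal)
  have h1 : ∫ x, ⟪Torus.fderiv w x (v x), v x⟫_ℝ = ∫ x, ⟪Torus.fderiv w x (p x), p x⟫_ℝ := by
    refine integral_congr_ae ?_
    filter_upwards [fourierTruncate_ae_eq_of_level hu] with x hx
    have hx' : p x = v x := hx
    rw [← hx']
  rw [h1]
  -- antisymmetry of the trilinear form and `w = -Δp`
  have h2 : ∫ x, ⟪Torus.fderiv w x (p x), p x⟫_ℝ = ∫ x, ⟪Torus.convect p w x, p x⟫_ℝ := rfl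
  rw [h2, Torus.integral_inner_convect_eq_neg hp hpdiv hw hp]
  simp_rw [hw_eq, inner_neg_left, integral_neg, neg_neg]
  exact Torus.integral_inner_laplacian_convect_self_eq_zero hp hpdiv

/-- **The enstrophy row integrand on level-`N` fields of `𝕋²`**:
`⟨F(u), A P_N u⟩ = ∫ ⟪f, A P_N u⟫ − ν · 16π⁴ Σ_{|k|≤N} |k|⁴ ‖û(k)‖²`. [folklore] -/
theorem nsGeneratorPairing_stokesTruncate_of_level (ν : ℝ) (f : Vec (Fin 2)) {N : ℕ} {u : HH (Fin 2)}
    (hu : ∀ k ∉ (Torus.freqBall N).erase (0 : Fin 2 → ℤ),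
      mFourierCoeff (EuclideanSpace.complexify ∘ ((u : L2T (Fin 2)) : Vec (Fin 2))) k = 0) :
    Torus.nsGeneratorPairing ν f u (Torus.realTrigPoly (Torus.freqBall N)
        (fun k => (((4 * Real.pi ^ 2 * Torus.freqNormSq k : ℝ)) : ℂ) •
          mFourierCoeff (EuclideanSpace.complexify ∘ ((u : L2T (Fin 2)) : Vec (Fin 2))) k)) =
      (∫ x, ⟪f x, Torus.realTrigPoly (Torus.freqBall N)
        (fun k => (((4 * Real.pi ^ 2 * Torus.freqNormSq k : ℝ)) : ℂ) •
          mFourierCoeff (EuclideanSpace.complexify ∘ ((u : L2T (Fin 2)) : Vec (Fin 2))) k) x⟫_ℝ) -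
        ν * ∑ k ∈ Torus.freqBall N, (4 * Real.pi ^ 2 * Torus.freqNormSq k) ^ 2 *
          ‖mFourierCoeff (EuclideanSpace.complexify ∘ ((u : L2T (Fin 2)) : Vec (Fin 2))) k‖ ^ 2 := by
  have hint : Integrable ((u : L2T (Fin 2)) : Vec (Fin 2)) volume :=
    (Lp.memLp (u : L2T (Fin 2))).integrable one_le_two
  rw [Torus.nsGeneratorPairing, inertialPairing_stokesTruncate_eq_zero hu, add_zero,
    integral_inner_laplacian_stokesTruncate hint N]
  ring

/-! ## The Galerkin frame fields are admissible level-`N` tests -/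

/-- A single real mode `Re (e_k • z)` with `0 < |k| ≤ N` is band-limited to level `N`. [folklore] -/
theorem mFourierCoeff_realTrigPoly_singleton_eq_zero_of_not_mem {N : ℕ} {k : d → ℤ}
    (hk : k ∈ Torus.freqBall₀ (d := d) N) (z : (d → ℤ) → EuclideanSpace ℂ d)
    {k' : d → ℤ} (hk' : k' ∉ (Torus.freqBall N).erase (0 : d → ℤ)) :
    mFourierCoeff (EuclideanSpace.complexify ∘ Torus.realTrigPoly {k} z) k' = 0 := by
  have hk0 : k ≠ 0 := (Finset.mem_erase.1 hk).1
  have hkB : k ∈ Torus.freqBall N := (Finset.mem_erase.1 hk).2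
  refine Torus.mFourierCoeff_realTrigPoly_eq_zero_of_not_mem z ?_ ?_
  · rw [Finset.mem_singleton]
    rintro rfl
    exact hk' hk
  · rw [Finset.mem_singleton]
    intro h
    apply hk'
    rw [show k' = -k by rw [← h, neg_neg]]
    exact Finset.mem_erase.2 ⟨neg_ne_zero.2 hk0, Torus.neg_mem_freqBall.2 hkB⟩

/-- The fields of `Torus.galerkinTest N` are smooth, divergence-free, mean-zero and band-limited to
level `N` (admissible tests of the route's stationarity clause). [folklore] -/
theorem galerkinTest_band (N : ℕ) (i : Fin (Torus.galerkinTest (d := d) N one_pos).m) :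
    Torus.IsSmooth ((Torus.galerkinTest (d := d) N one_pos).g i) ∧
      Torus.IsDivFree ((Torus.galerkinTest (d := d) N one_pos).g i) ∧
      Torus.HasZeroMean ((Torus.galerkinTest (d := d) N one_pos).g i) ∧
      ∀ k ∉ (Torus.freqBall N).erase (0 : d → ℤ),
        mFourierCoeff (EuclideanSpace.complexify ∘ ((Torus.galerkinTest (d := d) N one_pos).g i)) k = 0 := by
  refine ⟨(Torus.galerkinTest (d := d) N one_pos).g_smooth i,
    (Torus.galerkinTest (d := d) N one_pos).g_divFree i,
    (Torus.galerkinTest (d := d) N one_pos).g_zeroMean i, fun k' hk' => ?_⟩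
  change mFourierCoeff (EuclideanSpace.complexify ∘ Torus.frameField _ _ _) k' = 0
  exact mFourierCoeff_realTrigPoly_singleton_eq_zero_of_not_mem (Finset.coe_mem _) _ hk'

end PlanarCubicQuiet

end Summit.AnomalousDissipation.AnomalousDissipation.Theorems

end
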